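import Literature.AlgebraicGeometry.HodgeTheory.ClassesSupportedOnComplexification
import Literature.AlgebraicGeometry.HodgeTheory.HodgeTypeConjugation
import HarnessLib

/-!
# André 1992 in product form, carrier lemmas III: kernel components and masked components of rational `(p,q)`-classes

Part of the Literature-side proof of André's theorem in product form (record
`HodgeTheory.Andre1992_hodgeClasses_cmTypedProduct_mem_span_pullback_weilLines`; André 1992, Théorème = Deligne–Milne
LNM 900 endnote M.12 = Charles–Schnell 2014 Thm. 11.5.21 = Milne 2020 Thm. 1), discharged in
`ComplexMultiplication/AndreProductFormHolds.lean`. Linear algebra on the carriers `complexBetti`; nothing about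
algebraic cycles is asserted.

* Part 1 (kernel component). If a linear operator `Q` on `Hᵏ(X(ℂ); ℂ)` preserves rational classes and every Hodge
  type and `ker Q ⊓ im Q = ⊥`, then the `ker Q`-component of a rational class of type `(p,q)` (along
  `Hᵏ = ker Q ⊕ im Q`) is again rational of type `(p,q)` (`isRationalClass_and_isOfHodgeType_of_ker_component`;
  rational classes and the `H^{p,q}` are complex subspaces stable under such `Q`, Voisin I §7.1.1, §11.3.2).
* Part 2 (masked component). For finitely many such operators `Q r` DIAGONAL on a basis `Bw` with eigenvalues
  `q r S`, the masked part `y_D = Σ_{S : ∀ r, q r S = 0} (Bw.repr y S) • Bw S` of a rational `(p,q)`-class `y` is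
  rational of type `(p,q)` (`masked_component_rational_hodge`; induction on the number of operators) — the
  single-label component of Deligne's argument, LNM 900 §4 (4.3)–(4.4).

## References
* [Deligne1982HodgeCycles] P. Deligne (notes by J. S. Milne), LNM 900 (1982), §4 (4.3)–(4.4), endnote M.12.
* [VoisinHodgeI2002] C. Voisin, *Hodge Theory and Complex Algebraic Geometry I* (2002), §7.1.1, §11.3.2.
* [Andre1992HodgeCM] Y. André, *Une remarque à propos des cycles de Hodge de type CM*, Progr. Math. 102 (1992) 1–7.
-/

noncomputable section

namespace Literature.AlgebraicGeometry.ComplexMultiplication.AndreProductForm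

/-! ## Part 1: the kernel component of a rational `(p,q)`-class -/

section Part1

open Literature.AlgebraicTopology.SingularHomology
open Literature.AlgebraicGeometry Literature.AlgebraicGeometry.HodgeTheory

/-- **The kernel component of a vector of a `Q`-stable form lies in the form** (linear algebra).
Let `Q` be an `L`-linear endomorphism of `V` with `ker Q ⊓ im Q = ⊥`, `W` a finite-dimensional
`K`-vector space and `ι : W →+ V` injective, `K`-homogeneous for some `φ : K → L`, with
`Q (ι W) ⊆ ι W`. If `c = a + b` with `a ∈ ker Q`, `b ∈ im Q` and `c ∈ ι W`, then `a ∈ ι W`: the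
restriction `Q₀ : W → W` of `Q` has `ker Q₀ ⊓ im Q₀ = ⊥`, so `W = ker Q₀ ⊕ im Q₀` by rank–nullity,
and the decomposition of `c` inside `W` agrees with `c = a + b` because `ker Q ⊓ im Q = ⊥`.
 [cite: Deligne1982HodgeCycles, §4 (4.3)–(4.4), auxiliary step] -/
theorem mem_range_of_ker_component {K L W V : Type*} [Field K] [AddCommGroup W] [Module K W]
    [FiniteDimensional K W] [Ring L] [AddCommGroup V] [Module L V]
    (φ : K → L) (ι : W →+ V) (hι : Function.Injective ι)
    (hιsmul : ∀ (t : K) (w : W), ι (t • w) = φ t • ι w)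
    (Q : V →ₗ[L] V) (hQι : ∀ w : W, ∃ w' : W, ι w' = Q (ι w))
    (hdisj : Disjoint (LinearMap.ker Q) (LinearMap.range Q))
    {c a b : V} (ha : a ∈ LinearMap.ker Q) (hb : b ∈ LinearMap.range Q) (hc : c = a + b)
    (hcι : c ∈ Set.range ι) : a ∈ Set.range ι := by
  choose f hf using hQι
  -- the restriction `Q₀` of `Q` to the `K`-form `W` (`ι ∘ Q₀ = Q ∘ ι`)
  let Q₀ : W →ₗ[K] W :=
    { toFun := f
      map_add' := fun x y ↦ hι (by simp only [hf, map_add])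
      map_smul' := fun t x ↦ hι (by simp only [hf, RingHom.id_apply, hιsmul, map_smul]) }
  have hQ₀ : ∀ w, ι (Q₀ w) = Q (ι w) := hf
  -- `ι` maps `ker Q₀` into `ker Q` and `im Q₀` into `im Q`, so they are disjoint
  have hker : ∀ w ∈ LinearMap.ker Q₀, ι w ∈ LinearMap.ker Q := fun w hw ↦ by
    rw [LinearMap.mem_ker] at hw ⊢
    rw [← hQ₀, hw, map_zero]
  have hran : ∀ w ∈ LinearMap.range Q₀, ι w ∈ LinearMap.range Q := fun w hw ↦ by
    obtain ⟨w', rfl⟩ := LinearMap.mem_range.1 hw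
    exact LinearMap.mem_range.2 ⟨ι w', (hQ₀ w').symm⟩
  have hd₀ : Disjoint (LinearMap.ker Q₀) (LinearMap.range Q₀) := by
    refine Submodule.disjoint_def.2 fun w hw₁ hw₂ ↦ hι ?_
    rw [map_zero]
    exact Submodule.disjoint_def.1 hdisj _ (hker w hw₁) (hran w hw₂)
  -- rank–nullity: `W = ker Q₀ ⊕ im Q₀`
  have htop : LinearMap.ker Q₀ ⊔ LinearMap.range Q₀ = ⊤ :=
    Submodule.eq_top_of_disjoint _ _
      (le_of_eq (by rw [add_comm, LinearMap.finrank_range_add_finrank_ker])) hd₀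
  -- decompose `c = ι r` inside `W` and compare with `c = a + b`
  obtain ⟨r, hr⟩ := hcι
  have hr' : r ∈ LinearMap.ker Q₀ ⊔ LinearMap.range Q₀ := by
    rw [htop]
    exact Submodule.mem_top
  obtain ⟨r₁, hr₁, r₂, hr₂, rfl⟩ := Submodule.mem_sup.1 hr'
  refine ⟨r₁, ?_⟩
  have h₁ : a - ι r₁ ∈ LinearMap.ker Q := Submodule.sub_mem _ ha (hker r₁ hr₁)
  have h₂ : a - ι r₁ ∈ LinearMap.range Q := by
    have e : a - ι r₁ = ι r₂ - b := by
      rw [sub_eq_sub_iff_add_eq_add, ← hc, ← hr, map_add, add_comm]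
    rw [e]
    exact Submodule.sub_mem _ (hran r₂ hr₂) hb
  have h₀ : a - ι r₁ = 0 := Submodule.disjoint_def.1 hdisj _ h₁ h₂
  exact (sub_eq_zero.1 h₀).symm

/-- **The kernel component of a rational `(p, q)`-class is rational and of type `(p, q)`**. For `X` smooth projective of dimension `n`, a complex-linear
`Q : Hᵏ(X(ℂ); ℂ) → Hᵏ(X(ℂ); ℂ)` which maps rational classes to rational classes and classes of type
`(p, q)` to classes of type `(p, q)` (e.g. a `ℚ`-combination of pull-backs along endomorphisms,
Voisin I §11.3.2), with `ker Q ⊓ im Q = ⊥`, and a decomposition `c = a + b`, `a ∈ ker Q`,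
`b ∈ im Q`: if `c` is rational then so is `a` (`mem_range_of_ker_component` for the `ℚ`-form
`ofRatClass : Hᵏ(X(ℂ); ℚ) ↪ Hᵏ(X(ℂ); ℂ)`, injective and with image the rational classes, `Hᵏ(X(ℂ); ℚ)`
finite-dimensional); if `c` is of type `(p, q)` then so is `a` (`mem_range_of_ker_component` for the
`Q`-stable complex subspace of classes of type `(p, q)` of the finite-dimensional
`Hᵏ(X(ℂ); ℂ) ≃ Hᵏ(X(ℂ); ℚ) ⊗ ℂ`). [cite: VoisinHodgeI2002, §7.1.1] -/
theorem isRationalClass_and_isOfHodgeType_of_ker_component : ∀ {n : ℕ} {X : Literature.AlgebraicGeometry.Motives.SchemeOver ℂ}, Literature.AlgebraicGeometry.Motives.IsSmoothProjective n X → ∀ {k : ℕ} (Q : Literature.AlgebraicGeometry.HodgeTheory.complexBetti X k →ₗ[ℂ] Literature.AlgebraicGeometry.HodgeTheory.complexBetti X k), (∀ c, Literature.AlgebraicGeometry.HodgeTheory.IsRationalClass c → Literature.AlgebraicGeometry.HodgeTheory.IsRationalClass (Q c)) → (∀ (p q : ℕ) c, Literature.AlgebraicGeometry.HodgeTheory.IsOfHodgeType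 n X k p q c → Literature.AlgebraicGeometry.HodgeTheory.IsOfHodgeType n X k p q (Q c)) → Disjoint (LinearMap.ker Q) (LinearMap.range Q) → ∀ (c a b : Literature.AlgebraicGeometry.HodgeTheory.complexBetti X k), a ∈ LinearMap.ker Q → b ∈ LinearMap.range Q → c = a + b → (Literature.AlgebraicGeometry.HodgeTheory.IsRationalClass c → Literature.AlgebraicGeometry.HodgeTheory.IsRationalClass a) ∧ (∀ p q : ℕ, Literature.AlgebraicGeometry.HodgeTheory.IsOfHodgeType n X k p q c → Literature.AlgebraicGeometry.HodgeTheory.IsOfHodgeType n X k p q a) := by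
  intro n X hX k Q hQrat hQhodge hdisj c a b ha hb hc
  haveI : FiniteDimensional ℚ (Motives.bettiCohomology X k) := finiteDimensional_bettiCohomology hX k
  refine ⟨fun hcrat ↦ ?_, fun p q hcH ↦ ?_⟩
  · -- the `ℚ`-form `ι = ofRatClass : Hᵏ(X(ℂ); ℚ) ↪ Hᵏ(X(ℂ); ℂ)`
    have h := mem_range_of_ker_component (fun t : ℚ ↦ (t : ℂ))
      (ofRatClass (Motives.ComplexPoints X) k) (ofRatClass_injective k)
      (Motives.ofRatClass_smul (Motives.ComplexPoints X) k) Q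
      (fun w ↦ (isRationalClass_iff_mem_range_ofRatClass _).1
        (hQrat _ (isRationalClass_ofRatClass w)))
      hdisj ha hb hc ((isRationalClass_iff_mem_range_ofRatClass c).1 hcrat)
    exact (isRationalClass_iff_mem_range_ofRatClass a).2 h
  · -- the complex subspace of classes of type `(p, q)`, inside the finite-dimensional `Hᵏ(X(ℂ); ℂ)`
    haveI : FiniteDimensional ℂ (complexBetti X k) :=
      LinearEquiv.finiteDimensional (ofRatClassBaseChangeEquiv hX k)
    obtain ⟨A, -⟩ := id hcH
    let W : Submodule ℂ (complexBetti X k) :=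
      { carrier := {x | IsOfHodgeType n X k p q x}
        add_mem' := fun hx hy ↦ hx.add hX hy
        zero_mem' := IsOfHodgeType.zero A k p q
        smul_mem' := fun t x hx ↦ IsOfHodgeType.smul hx t }
    have h := mem_range_of_ker_component (fun t : ℂ ↦ t) W.subtype.toAddMonoidHom
      W.injective_subtype (fun _ _ ↦ rfl) Q
      (fun w ↦ ⟨⟨Q w, hQhodge p q w w.2⟩, rfl⟩) hdisj ha hb hc ⟨⟨c, hcH⟩, rfl⟩
    obtain ⟨w, hw⟩ := h
    rw [← hw]
    exact w.2

end Part1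

/-! ## Part 2: the masked component -/

section Part2

open Literature.AlgebraicTopology.SingularHomology
open Literature.AlgebraicGeometry Literature.AlgebraicGeometry.HodgeTheory

/-- **Coordinates of a masked vector**: in a basis `b`, the `T`-th coordinate of
`Σ_{S ∈ s} f S • b S` is `f T` if `T ∈ s` and `0` otherwise. [cite: Deligne1982HodgeCycles, §4 (4.3)–(4.4), auxiliary step] -/
theorem repr_sum_smul_basis_apply {K V J : Type*} [Semiring K] [AddCommMonoid V] [Module K V]
    [DecidableEq J] (b : Module.Basis J K V) (s : Finset J) (f : J → K) (T : J) :
    b.repr (∑ S ∈ s, f S • b S) T = if T ∈ s then f T else 0 := by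
  simp only [map_sum, map_smul, Module.Basis.repr_self, Finsupp.smul_single, smul_eq_mul,
    mul_one, Finsupp.finsetSum_apply, Finsupp.single_apply]
  rw [Finset.sum_ite_eq']

/-- **Coordinates of the image under a diagonal operator**: if `Q (b S) = q S • b S` for every
basis vector, then the `T`-th coordinate of `Q z` is `q T` times the `T`-th coordinate of `z`.
 [cite: Deligne1982HodgeCycles, §4 (4.3)–(4.4), auxiliary step] -/
theorem repr_apply_of_diagonal {K V J : Type*} [Field K] [AddCommGroup V] [Module K V]
    [Fintype J] (b : Module.Basis J K V) (Q : V →ₗ[K] V) (q : J → K)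
    (hQ : ∀ S, Q (b S) = q S • b S) (z : V) (T : J) :
    b.repr (Q z) T = q T * b.repr z T := by
  classical
  conv_lhs => rw [← b.sum_repr z]
  simp only [map_sum, map_smul, hQ, Module.Basis.repr_self, Finsupp.smul_single, smul_eq_mul,
    mul_one, Finsupp.finsetSum_apply, Finsupp.single_apply]
  rw [Finset.sum_ite_eq', if_pos (Finset.mem_univ T), mul_comm]

/-- **A diagonalisable operator has `ker Q ⊓ im Q = ⊥`**: if `Q` is diagonal in a finite basis,
then a vector `Q z` killed by `Q` has coordinates `q T · repr z T` with `q T ^ 2 · repr z T = 0`,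
hence vanishes. [cite: Deligne1982HodgeCycles, §4 (4.3)–(4.4), auxiliary step] -/
theorem disjoint_ker_range_of_diagonal {K V J : Type*} [Field K] [AddCommGroup V] [Module K V]
    [Fintype J] (b : Module.Basis J K V) (Q : V →ₗ[K] V) (q : J → K)
    (hQ : ∀ S, Q (b S) = q S • b S) : Disjoint (LinearMap.ker Q) (LinearMap.range Q) := by
  refine Submodule.disjoint_def.2 fun x hx₁ hx₂ ↦ ?_
  obtain ⟨z, rfl⟩ := LinearMap.mem_range.1 hx₂
  rw [LinearMap.mem_ker] at hx₁
  refine b.ext_elem fun T ↦ ?_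
  have h := congrArg (fun v ↦ b.repr v T) hx₁
  simp only [repr_apply_of_diagonal b Q q hQ, map_zero, Finsupp.zero_apply] at h ⊢
  rcases mul_eq_zero.1 h with h0 | h0
  · rw [h0, zero_mul]
  · exact h0

/-- **One diagonal operator: the mask onto the eigenvalue `0` is the kernel component** (helper
toward W10). For `X` smooth projective, a basis `Bw` of `Hᵏ(X(ℂ); ℂ)` and a complex-linear `Q`
preserving rational classes and Hodge types with `Q (Bw S) = q S • Bw S`: the mask
`Σ_{q S = 0} repr y S • Bw S` of `y` is rational if `y` is and of type `(p, q₀)` if `y` is — it is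
the `ker Q`-component of `y` in `Hᵏ = ker Q ⊕ im Q`, and
`isRationalClass_and_isOfHodgeType_of_ker_component` applies. [cite: VoisinHodgeI2002, §7.1.1] -/
theorem masked_component_one {n : ℕ} {X : Motives.SchemeOver ℂ} (hX : Motives.IsSmoothProjective n X)
    {k : ℕ} {J : Type} [Fintype J] [DecidableEq J] (Bw : Module.Basis J ℂ (complexBetti X k))
    (Q : complexBetti X k →ₗ[ℂ] complexBetti X k) (q : J → ℂ)
    (hQrat : ∀ c, IsRationalClass c → IsRationalClass (Q c))
    (hQhodge : ∀ (p q₀ : ℕ) c, IsOfHodgeType n X k p q₀ c → IsOfHodgeType n X k p q₀ (Q c))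
    (hdiag : ∀ S, Q (Bw S) = q S • Bw S) (y : complexBetti X k) :
    (IsRationalClass y →
      IsRationalClass (∑ S ∈ Finset.univ.filter (fun S => q S = 0), Bw.repr y S • Bw S)) ∧
    (∀ p q₀ : ℕ, IsOfHodgeType n X k p q₀ y →
      IsOfHodgeType n X k p q₀ (∑ S ∈ Finset.univ.filter (fun S => q S = 0), Bw.repr y S • Bw S)) := by
  refine isRationalClass_and_isOfHodgeType_of_ker_component hX Q hQrat hQhodge
    (disjoint_ker_range_of_diagonal Bw Q q hdiag) y _
    (∑ S ∈ Finset.univ.filter (fun S => ¬ q S = 0), Bw.repr y S • Bw S) ?_ ?_ ?_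
  · -- the mask lies in `ker Q`
    rw [LinearMap.mem_ker, map_sum]
    refine Finset.sum_eq_zero fun S hS ↦ ?_
    rw [map_smul, hdiag, (Finset.mem_filter.1 hS).2, zero_smul, smul_zero]
  · -- the complementary mask lies in `im Q`
    refine LinearMap.mem_range.2
      ⟨∑ S ∈ Finset.univ.filter (fun S => ¬ q S = 0), (Bw.repr y S * (q S)⁻¹) • Bw S, ?_⟩
    rw [map_sum]
    refine Finset.sum_congr rfl fun S hS ↦ ?_
    rw [map_smul, hdiag, smul_smul, mul_assoc, inv_mul_cancel₀ (Finset.mem_filter.1 hS).2, mul_one]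
  · -- the two masks add up to `y`
    rw [Finset.sum_filter_add_sum_filter_not, Bw.sum_repr]

/-- **The masked component of a rational `(p, q₀)`-class is rational and of type `(p, q₀)`**. For `X` smooth projective of dimension `n`, a basis `Bw` of
`Hᵏ(X(ℂ); ℂ)` and finitely many complex-linear operators `Q r` (`r : Fin m`) which map rational
classes to rational classes and classes of type `(p, q₀)` to classes of type `(p, q₀)` (e.g.
`ℚ`-combinations of pull-backs along endomorphisms, Voisin I §11.3.2) and are diagonal on `Bw`
with eigenvalues `q r S`: the joint mask `Σ_{S : ∀ r, q r S = 0} repr y S • Bw S` of a class `y` is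
rational if `y` is, and of type `(p, q₀)` if `y` is. Induction on `m`: the mask for `Q 0` of the
joint mask for `Q 1, …, Q m` is the joint mask for all of them (coordinates of a masked vector,
`repr_sum_smul_basis_apply`), and each single mask preserves rationality and Hodge type
(`masked_component_one`, from `isRationalClass_and_isOfHodgeType_of_ker_component`).
[cite: VoisinHodgeI2002, §7.1.1] -/
theorem masked_component_rational_hodge : ∀ {n : ℕ} {X : Literature.AlgebraicGeometry.Motives.SchemeOver ℂ}, Literature.AlgebraicGeometry.Motives.IsSmoothProjective n X → ∀ {k m : ℕ} {J : Type} [Fintype J] [DecidableEq J] (Bw : Module.Basis J ℂ (Literature.AlgebraicGeometry.HodgeTheory.complexBetti X k)) (Q : Fin m → (Literature.AlgebraicGeometry.HodgeTheory.complexBetti X k →ₗ[ℂ] Literature.AlgebraicGeometry.HodgeTheory.complexBetti X k)) (q : Fin m → J → ℂ), (∀ r c, Literature.AlgebraicGeometry.HodgeTheory.IsRationalClass c → Literature.AlgebraicGeometry.HodgeTheory.IsRationalClass (Q r c)) → (∀ r (p q0 : ℕ) c, Literature.AlgebraicGeometry.HodgeTheory.IsOfHodgeType n X k p q0 c → Literature.AlgebraicGeometry.HodgeTheory.IsOfHodgeType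 n X k p q0 (Q r c)) → (∀ r S, Q r (Bw S) = q r S • Bw S) → ∀ y : Literature.AlgebraicGeometry.HodgeTheory.complexBetti X k, (Literature.AlgebraicGeometry.HodgeTheory.IsRationalClass y → Literature.AlgebraicGeometry.HodgeTheory.IsRationalClass (∑ S ∈ Finset.univ.filter (fun S => ∀ r, q r S = 0), Bw.repr y S • Bw S)) ∧ (∀ p q0 : ℕ, Literature.AlgebraicGeometry.HodgeTheory.IsOfHodgeType n X k p q0 y → Literature.AlgebraicGeometry.HodgeTheory.IsOfHodgeType n X k p q0 (∑ S ∈ Finset.univ.filter (fun S => ∀ r, q r S = 0), Bw.repr y S • Bw S)) := by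
  intro n X hX k m
  induction m with
  | zero =>
    intro J _ _ Bw Q q _ _ _ y
    have e : (∑ S ∈ Finset.univ.filter (fun S => ∀ r : Fin 0, q r S = 0), Bw.repr y S • Bw S) = y := by
      rw [Finset.filter_true_of_mem (fun S _ r ↦ r.elim0), Bw.sum_repr]
    rw [e]
    exact ⟨id, fun _ _ ↦ id⟩
  | succ m ih =>
    intro J _ _ Bw Q q hQrat hQhodge hdiag y
    -- the joint mask for the operators `Q 1, …, Q m`
    set y' : complexBetti X k :=
      ∑ S ∈ Finset.univ.filter (fun S => ∀ r : Fin m, q r.succ S = 0), Bw.repr y S • Bw S with hy'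
    have h₁ := ih Bw (fun r ↦ Q r.succ) (fun r ↦ q r.succ) (fun r ↦ hQrat r.succ)
      (fun r ↦ hQhodge r.succ) (fun r ↦ hdiag r.succ) y
    -- followed by the mask for `Q 0`
    have h₂ := masked_component_one hX Bw (Q 0) (q 0) (hQrat 0) (hQhodge 0) (hdiag 0) y'
    -- is the joint mask for all of them
    have e : (∑ S ∈ Finset.univ.filter (fun S => q 0 S = 0), Bw.repr y' S • Bw S) =
        ∑ S ∈ Finset.univ.filter (fun S => ∀ r : Fin (m + 1), q r S = 0), Bw.repr y S • Bw S := by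
      rw [Finset.sum_filter, Finset.sum_filter]
      refine Finset.sum_congr rfl fun S _ ↦ ?_
      rw [hy', repr_sum_smul_basis_apply]
      by_cases h0 : q 0 S = 0
      · by_cases hs : ∀ r : Fin m, q r.succ S = 0
        · rw [if_pos h0, if_pos (Finset.mem_filter.2 ⟨Finset.mem_univ S, hs⟩),
            if_pos (Fin.forall_fin_succ.2 ⟨h0, hs⟩)]
        · rw [if_pos h0, if_neg (fun h ↦ hs (Finset.mem_filter.1 h).2), zero_smul,
            if_neg (fun h ↦ hs (Fin.forall_fin_succ.1 h).2)]
      · rw [if_neg h0, if_neg (fun h ↦ h0 (Fin.forall_fin_succ.1 h).1)]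
    rw [← e]
    exact ⟨fun hy ↦ h₂.1 (h₁.1 hy), fun p q0 hy ↦ h₂.2 p q0 (h₁.2 p q0 hy)⟩

end Part2

end Literature.AlgebraicGeometry.ComplexMultiplication.AndreProductForm

end
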